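import Summits.HubbardSuperconductivity.HubbardSuperconductivity.Theorems.AnisotropyChordFourTorusTrialStates

/-!
# Route `AnisotropyChord` / crux `ChordXY` at `M = 4`: the FAR piece `Δ ∈ [−1, −17/200]` and the KLS-point constants
# (prover seat `hubbard-h0-rotor-p1` g18)

* `lowerNormSq_ge_far`: for `−1 ≤ Δ ≤ −17/200` the sector-`0` Perron amplitude `a` of `H₄(Δ)` has `(139/2)(1+Δ) ≤ ‖S⁻a‖²` —
  the affine family of class-space certificates `L − (139/2)(1+Δ)N + 60(𝓔_Δ − R̃_b(Δ)N) ⪰ 0` (kernel-certified at the two endpoints,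
  `certY5`, `certY6`; affine in `Δ` in between) evaluated at the Perron class vector, with the Rayleigh–Ritz bound
  `E₀(Δ) + 8 ≤ R̃_b(Δ)` of the symmetric trial state `wb` (`rayleigh_trial`).
* KLS-point constants of the sector-`0` Perron amplitude `a₀` of `H₄(0)`: `133/2 ≤ Λ₀ ≤ 139/2` (`certY2`, `certY3`),
  `⟨W⟩₀ ≤ −5/4` (`certY4`), `‖(W + 3/2)a₀‖² ≤ 23/10` (`certY1`), all via `rr_zero`.
-/

set_option linter.style.longLine false
set_option linter.dupNamespace false
set_option autoImplicit false

open Finset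
open Literature.MathematicalPhysics.QuantumLattice Literature.Probability.LatticeModels
open Summit.HubbardSuperconductivity.HubbardSuperconductivity.Theorems.AnisotropyChord.Tower
open Summit.HubbardSuperconductivity.HubbardSuperconductivity.Theorems.AnisotropyChord.InsertionEntropy

namespace Summit.HubbardSuperconductivity.HubbardSuperconductivity.Theorems.AnisotropyChord.FourTorus

/-- the Perron data in reduced forms: `N(v) = 1`, `A(v) + (1−Δ)W(v) = E₀(Δ) + 8`, `L(v) = ‖S⁻a‖²`. [folklore] -/
theorem perron_forms {Δ : ℝ} {a : Cfg → ℝ} (ha : IsPerronSectorGroundAmplitude 4 Δ 0 a) :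
    normC (fun r => a (decode (rep8 r))) = 1 ∧
    hopC (fun r => a (decode (rep8 r))) + (1 - Δ) * isingC (fun r => a (decode (rep8 r)))
      = lowestEnergyInSector 1 (xxzHamiltonian 1 (torusGraph 2 4) (-1) Δ) 0 + 8 ∧
    lowerC (fun r => a (decode (rep8 r))) = lowerNormSq a := by
  obtain ⟨hN, hW, hL, hA⟩ := (symAmp_of_perron ha).forms
  refine ⟨by rw [← hN, ha.unit], ?_, hL.symm⟩
  have hE := perron_energy_four ha
  have hsplit : ∑ σ, a σ * (fmOp (torusGraph 2 4) a σ + (1 - Δ) * (isingW (torusGraph 2 4) σ * a σ))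
      = (∑ σ, a σ * fmOp (torusGraph 2 4) a σ) + (1 - Δ) * ∑ σ, isingW (torusGraph 2 4) σ * a σ ^ 2 := by
    rw [Finset.mul_sum, ← Finset.sum_add_distrib]; exact Finset.sum_congr rfl fun σ _ => by ring
  rw [hsplit, hA, hW] at hE
  exact hE

/-- **THE FAR PIECE:** for `−1 ≤ Δ ≤ −17/200` the sector-`0` Perron amplitude of `H₄(Δ)` has `(139/2)(1+Δ) ≤ ‖S⁻_tot a‖²`. [folklore] -/
theorem lowerNormSq_ge_far {Δ : ℝ} (h1 : -1 ≤ Δ) (h2 : Δ ≤ -17/200) {a : Cfg → ℝ} (ha : IsPerronSectorGroundAmplitude 4 Δ 0 a) :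
    139 / 2 * (1 + Δ) ≤ lowerNormSq a := by
  set v : ℕ → ℝ := fun r => a (decode (rep8 r)) with hv
  obtain ⟨hN, hE, hL⟩ := perron_forms ha
  have h5 := certY5 v
  have h6 := certY6 v
  have hrr := rayleigh_trial sigInvariant_wa_wb.2 Δ
  -- the trial energies in kernel scalars
  have hnb : normC (fun r => (wb r : ℝ)) = (nbc : ℝ) := by rw [normC_nat]; unfold nbc; push_cast; rfl
  have hAb : 4 * hopC (fun r => (wb r : ℝ)) = (hbc : ℝ) := by rw [hopC_nat]; rfl
  have hWb : 2 * isingC (fun r => (wb r : ℝ)) = (wbc : ℝ) := by rw [isingC_nat]; rfl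
  have hebm : (ebm : ℝ) = (hbc : ℝ) + 4 * (wbc : ℝ) := by rw [show ebm = hbc + 4 * wbc from rfl, Int.cast_add, Int.cast_mul]; norm_num
  have hebj : (ebj : ℝ) = 12000 * (hbc : ℝ) + 26040 * (wbc : ℝ) := by
    rw [show ebj = 12000 * hbc + 26040 * wbc from rfl, Int.cast_add, Int.cast_mul, Int.cast_mul]; norm_num
  rw [hnb] at hrr
  set d : ℝ := 1 + Δ with hd
  have hd0 : 0 ≤ d := by linarith
  have hd1 : 0 ≤ 183 - 200 * d := by linarith
  set Ab := hopC (fun r => (wb r : ℝ)) with hAbdef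
  set Wb := isingC (fun r => (wb r : ℝ)) with hWbdef
  set E8 := lowestEnergyInSector 1 (xxzHamiltonian 1 (torusGraph 2 4) (-1) Δ) 0 + 8 with hE8
  -- the non-negative affine combination of the two endpoint certificates
  have hS : 0 ≤ (183 - 200 * d) * 200 * ((nbc : ℝ) * (4 * lowerC v + 240 * hopC v + 480 * isingC v) - 60 * (ebm : ℝ) * normC v)
      + 200 * d * ((nbc : ℝ) * (800 * lowerC v + 48000 * hopC v + 52080 * isingC v - 50874 * normC v) - (ebj : ℝ) * normC v) :=
    add_nonneg (mul_nonneg (mul_nonneg hd1 (by norm_num)) h5) (mul_nonneg (mul_nonneg (by norm_num) hd0) h6)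
  rw [hN, hebm, hebj, ← hAb, ← hWb] at hS
  -- the exact regrouping
  have key : (183 - 200 * d) * 200 * ((nbc : ℝ) * (4 * lowerC v + 240 * hopC v + 480 * isingC v) - 60 * (4 * Ab + 4 * (2 * Wb)) * 1)
      + 200 * d * ((nbc : ℝ) * (800 * lowerC v + 48000 * hopC v + 52080 * isingC v - 50874 * 1) - (12000 * (4 * Ab) + 26040 * (2 * Wb)) * 1)
      = 146400 * (nbc : ℝ) * (lowerC v - 139 / 2 * d) + 8784000 * ((nbc : ℝ) * (hopC v + (1 - Δ) * isingC v) - (Ab + (1 - Δ) * Wb)) := by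
    rw [hd]; ring
  rw [key, hE] at hS
  have hneg : (nbc : ℝ) * E8 - (Ab + (1 - Δ) * Wb) ≤ 0 := by rw [hE8]; linarith
  have hmain : 0 ≤ 146400 * (nbc : ℝ) * (lowerC v - 139 / 2 * d) := by linarith
  have : 0 ≤ lowerC v - 139 / 2 * d := by
    have hnbc : (0 : ℝ) < (nbc : ℝ) := by rw [nbc_val]; norm_num
    nlinarith
  rw [← hL]; linarith

/-! ## KLS-point constants of the sector-`0` Perron amplitude `a₀` of `H₄(0)` -/

/-- `133/2 ≤ Λ₀ ≤ 139/2`. [folklore] -/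
theorem lambda0_bounds {a₀ : Cfg → ℝ} (ha : IsPerronSectorGroundAmplitude 4 0 0 a₀) :
    133 / 2 ≤ lowerNormSq a₀ ∧ lowerNormSq a₀ ≤ 139 / 2 := by
  set v : ℕ → ℝ := fun r => a₀ (decode (rep8 r)) with hv
  obtain ⟨hN, hE, hL⟩ := perron_forms ha
  have h2 := certY2 v
  have h3 := certY3 v
  have hrr := rr_zero
  rw [hN] at h2 h3
  have hE' : hopC v + isingC v = lowestEnergyInSector 1 (xxzHamiltonian 1 (torusGraph 2 4) (-1) 0) 0 + 8 := by
    rw [← hE]; ring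
  have hp : (0 : ℝ) < (nac : ℝ) := by rw [nac_val]; norm_num
  constructor
  · rw [← hL]
    have : 0 ≤ (nac : ℝ) * (4 * lowerC v - 266) + (80 * (eac : ℝ) - 320 * (nac : ℝ) * (hopC v + isingC v)) := by nlinarith
    rw [hE'] at this
    nlinarith
  · rw [← hL]
    have : 0 ≤ (nac : ℝ) * (278 - 4 * lowerC v) + (240 * (nac : ℝ) * (hopC v + isingC v) - 60 * (eac : ℝ)) := by nlinarith
    rw [hE'] at this
    nlinarith

/-- `⟨W⟩₀ ≤ −5/4` (the Ising diagonal in the KLS-point ground state). [folklore] -/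
theorem isingMean0_le {a₀ : Cfg → ℝ} (ha : IsPerronSectorGroundAmplitude 4 0 0 a₀) :
    ∑ σ, isingW (torusGraph 2 4) σ * a₀ σ ^ 2 ≤ -5/4 := by
  set v : ℕ → ℝ := fun r => a₀ (decode (rep8 r)) with hv
  obtain ⟨hN, hE, hL⟩ := perron_forms ha
  obtain ⟨-, hW, -, -⟩ := (symAmp_of_perron ha).forms
  have h4 := certY4 v
  have hrr := rr_zero
  rw [hN] at h4
  have hE' : hopC v + isingC v = lowestEnergyInSector 1 (xxzHamiltonian 1 (torusGraph 2 4) (-1) 0) 0 + 8 := by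
    rw [← hE]; ring
  have hp : (0 : ℝ) < (nac : ℝ) := by rw [nac_val]; norm_num
  rw [hW]
  have : 0 ≤ (nac : ℝ) * (-4 * isingC v - 5) + (40 * (nac : ℝ) * (hopC v + isingC v) - 10 * (eac : ℝ)) := by nlinarith
  rw [hE'] at this
  nlinarith

/-- the squared deviation of the Ising diagonal from `−3/2` in class variables, for a symmetric amplitude. [folklore] -/
theorem SymAmp.sum_dev32_sq_eq {a : Cfg → ℝ} (hs : SymAmp a) :
    ∑ σ, (isingW (torusGraph 2 4) σ + 3/2) ^ 2 * a σ ^ 2 = dev32C (fun r => a (decode (rep8 r))) := by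
  have hR : dev32C (fun r => a (decode (rep8 r)))
      = ∑ r ∈ range 58, (n8 r : ℝ) * ((8 - (1/2 : ℝ) * (activeEdges r : ℝ) + 3/2) ^ 2 * a (decode (rep8 r)) ^ 2) := by
    unfold dev32C; exact Finset.sum_congr rfl fun r _ => by ring
  rw [hR, sum_config_eq_sum_range, ← sum_sector8]
  refine Finset.sum_congr rfl fun k hk => ?_
  have hk' := mem_range.1 hk
  by_cases hp : pop16 k = 8
  · rw [if_pos hp, isingW_four, brokenOrd_decode_class hk' hp, ← activeEdges_eq, hs.classValue hk' hp]
  · rw [if_neg hp, hs.decode_eq_zero hk' hp]; ring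

/-- `‖(W + 3/2)a₀‖² ≤ 23/10` (variance certificate). [folklore] -/
theorem dev32_a0_le {a₀ : Cfg → ℝ} (ha : IsPerronSectorGroundAmplitude 4 0 0 a₀) :
    ∑ σ, (isingW (torusGraph 2 4) σ + 3/2) ^ 2 * a₀ σ ^ 2 ≤ 23/10 := by
  set v : ℕ → ℝ := fun r => a₀ (decode (rep8 r)) with hv
  obtain ⟨hN, hE, hL⟩ := perron_forms ha
  have h1 := certY1 v
  have hrr := rr_zero
  rw [hN] at h1
  have hE' : hopC v + isingC v = lowestEnergyInSector 1 (xxzHamiltonian 1 (torusGraph 2 4) (-1) 0) 0 + 8 := by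
    rw [← hE]; ring
  have hp : (0 : ℝ) < (nac : ℝ) := by rw [nac_val]; norm_num
  rw [(symAmp_of_perron ha).sum_dev32_sq_eq]
  have : 0 ≤ (nac : ℝ) * (92 - 40 * dev32C v) + (800 * (nac : ℝ) * (hopC v + isingC v) - 200 * (eac : ℝ)) := by nlinarith
  rw [hE'] at this
  nlinarith

end Summit.HubbardSuperconductivity.HubbardSuperconductivity.Theorems.AnisotropyChord.FourTorus
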